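import Mathlib

/-!
# Hadamard 668 census, family F12 — the Frobenius class `Z₂₉ ⋊ Z₇` (four cyclotomic classes): orbit-matrix kernel theorem

Framing: lottery ticket; floor = certified bounds/negative ranges.

Cell pub-namedobj (venture DiscreteObjects), target (H), hadamard gen 5, family F12.  Hadamard g4 decided this class NONE
by a second-level double count on the `U₇`-fixed substructure (FAMILY-F12 §3b, refereed by verify-ref g41 who suggested the
Jensen form used below); it rested on three enumerations of the 102 admissible row profile-multisets.  This file is a
kernel certificate in the table-free ORBIT-MATRIX style of `Frobenius37Index4`: for `p = 29` (`667 = 23·29`, no fixed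
point, 23 point-orbits and 23 block-orbits of length 29) the orbit matrix `w i j = b i j + 7·z i j` (`b ∈ {0,1}` the
incidence of the `U`-fixed base elements, `z ∈ {0,…,4}` the number of `U`-cosets of size 7 in the type) satisfies
  rows  `Σ_j w i j = 333`,  `Σ_j (w i j)² = 167 + 166·29 = 4981`,   pairs  `Σ_j w i j · w i' j = 166·29 = 4814` (i ≠ i').
THEOREM (`no_frobenius29_index4`): no solution.  (A) `orbitRow29_7`: `Σ_j b i j ∈ {4, 18}` (aggregated second moments
with the termwise bounds `d - d² ≤ 2 b d ≤ d + d²`, `d = z - 2`); (B) `orbitPair29_7`: the pair equation is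
`Σ_j b b' ≡ 4814 ≡ 5 (mod 7)`, so `5 ≤ Σ_j b i j b i' j ≤ 12` and every row has `Σ_j b i j = 18`; (C) double count:
`Σ_i Σ_i' Σ_j b i j b i' j ≤ 23·18 + 23·22·12 = 6486`, but it equals `Σ_j c_j²` with column sums `Σ_j c_j = 23·18 = 414`,
hence `≥ 414²/23 = 7452` (Jensen, via `Σ_j (c_j - 18)² ≥ 0`).  The column equations are not needed.  In print this
class is already excluded (Lander 1983 Thm 3.20: every automorphism of order 29 of a 2-(667,333,166) design fixes an odd
number of points), so the file is a kernel-certified (−) CONTROL of the F12 calculus at the target parameters.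
Ours, not literature; no `sorry`, no `decide` beyond `Fin` literals, no `native_decide`.
-/

open Finset BigOperators

namespace Summit.Ventures.DiscreteObjects.Hadamard

/-! ## §A  One orbit-matrix row: the base-block count is 4 or 18 -/

/-- termwise facts for `b ∈ {0,1}` and an integer `t`: `t - t² ≤ 2·b·t ≤ t + t²` (integrality is essential) -/
lemma two_b_mul_bounds (b t : ℤ) (hb : b = 0 ∨ b = 1) : t - t ^ 2 ≤ 2 * (b * t) ∧ 2 * (b * t) ≤ t + t ^ 2 := by
  have h1 : t ≤ t ^ 2 := by
    rcases le_or_gt t 0 with h | h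
    · nlinarith [sq_nonneg t]
    · nlinarith
  have h2 : 0 ≤ t + t ^ 2 := by
    rcases le_or_gt 0 t with h | h
    · nlinarith [sq_nonneg t]
    · nlinarith [mul_nonneg (show (0:ℤ) ≤ -t by omega) (show (0:ℤ) ≤ -(t + 1) by omega)]
  rcases hb with rfl | rfl
  · constructor <;> linarith
  · constructor <;> linarith

/-- **Row lemma (29,7).**  For one row of the orbit matrix — 23 cells `w = b + 7 z`, `b ∈ {0,1}`, `0 ≤ z ≤ 4`, first
moment 333, second moment 4981 — the number of base blocks through the base point is `Σ b ∈ {4, 18}`. -/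
theorem orbitRow29_7 {ι : Type*} [Fintype ι] (hcard : Fintype.card ι = 23) (b z : ι → ℤ)
    (hb : ∀ j, b j = 0 ∨ b j = 1) (hz : ∀ j, 0 ≤ z j ∧ z j ≤ 4)
    (h1 : ∑ j, (b j + 7 * z j) = 333) (h2 : ∑ j, (b j + 7 * z j) ^ 2 = 4981) :
    ∑ j, b j = 4 ∨ ∑ j, b j = 18 := by
  have hcardι : (Finset.univ : Finset ι).card = 23 := by rw [Finset.card_univ, hcard]
  have e1 : ∑ j, (b j + 7 * z j) = ∑ j, b j + 7 * ∑ j, z j := by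
    rw [Finset.sum_add_distrib, Finset.mul_sum]
  have e2 : ∑ j, (b j + 7 * z j) ^ 2 = ∑ j, b j + 14 * ∑ j, b j * z j + 49 * ∑ j, z j ^ 2 := by
    have : ∀ j ∈ (Finset.univ : Finset ι), (b j + 7 * z j) ^ 2 = b j + 14 * (b j * z j) + 49 * z j ^ 2 := by
      intro j _
      have hbb : b j * b j = b j := by rcases hb j with h | h <;> simp [h]
      have : (b j + 7 * z j) ^ 2 = b j * b j + 14 * (b j * z j) + 49 * z j ^ 2 := by ring
      rw [this, hbb]
    rw [Finset.sum_congr rfl this, Finset.sum_add_distrib, Finset.sum_add_distrib, Finset.mul_sum, Finset.mul_sum]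
  have e3 : ∑ j, (z j - 2) ^ 2 = ∑ j, z j ^ 2 - 4 * ∑ j, z j + 92 := by
    have : ∀ j ∈ (Finset.univ : Finset ι), (z j - 2) ^ 2 = z j ^ 2 - 4 * z j + 4 := by intro j _; ring
    rw [Finset.sum_congr rfl this, Finset.sum_add_distrib, Finset.sum_sub_distrib, Finset.mul_sum, Finset.sum_const,
      hcardι]
    norm_num
  have e4 : ∑ j, b j * (z j - 2) = ∑ j, b j * z j - 2 * ∑ j, b j := by
    have : ∀ j ∈ (Finset.univ : Finset ι), b j * (z j - 2) = b j * z j - 2 * b j := by intro j _; ring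
    rw [Finset.sum_congr rfl this, Finset.sum_sub_distrib, Finset.mul_sum]
  have e5 : ∑ j, (z j - 2) = ∑ j, z j - 46 := by
    rw [Finset.sum_sub_distrib, Finset.sum_const, hcardι]; norm_num
  -- termwise bounds, summed:  Σ(d - d²) ≤ 2 Σ b d ≤ Σ(d + d²)
  have N1 : ∑ j, ((z j - 2) - (z j - 2) ^ 2) ≤ ∑ j, 2 * (b j * (z j - 2)) :=
    Finset.sum_le_sum fun j _ => (two_b_mul_bounds (b j) (z j - 2) (hb j)).1
  have N2 : ∑ j, 2 * (b j * (z j - 2)) ≤ ∑ j, ((z j - 2) + (z j - 2) ^ 2) :=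
    Finset.sum_le_sum fun j _ => (two_b_mul_bounds (b j) (z j - 2) (hb j)).2
  rw [Finset.sum_sub_distrib, e5, e3, ← Finset.mul_sum, e4] at N1
  rw [Finset.sum_add_distrib, e5, e3, ← Finset.mul_sum, e4] at N2
  have B0 : 0 ≤ ∑ j, b j := Finset.sum_nonneg fun j _ => by rcases hb j with h | h <;> simp [h]
  have B0' : ∑ j, b j ≤ 23 := by
    have : ∑ j, b j ≤ ∑ _j : ι, (1 : ℤ) := Finset.sum_le_sum fun j _ => by rcases hb j with h | h <;> simp [h]
    simpa [Finset.sum_const, hcardι] using this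
  have B1 : 0 ≤ ∑ j, b j * z j :=
    Finset.sum_nonneg fun j _ => by rcases hb j with h | h <;> simp [h, (hz j).1]
  have B2 : ∑ j, b j * z j ≤ 4 * ∑ j, b j := by
    rw [Finset.mul_sum]
    exact Finset.sum_le_sum fun j _ => by rcases hb j with h | h <;> simp [h, (hz j).2]
  rw [e1] at h1
  rw [e2] at h2
  generalize ∑ j, b j = Sb at *
  generalize ∑ j, z j = Sz at *
  generalize ∑ j, z j ^ 2 = Szz at *
  generalize ∑ j, b j * z j = Sbz at *
  interval_cases Sb <;> omega

/-! ## §B  Two rows: the base blocks meet in 5 or 12, so every row has 18 -/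

/-- **Pair lemma (29,7).**  The pair equation `Σ_j (b + 7z)(b' + 7z') = 4814 ≡ 5 (mod 7)` together with
`Σ b ∈ {4, 18}` forces `Σ b = 18` and `5 ≤ Σ_j b b' ≤ 12`. -/
theorem orbitPair29_7 {ι : Type*} [Fintype ι] (b z b' z' : ι → ℤ)
    (hb : ∀ j, b j = 0 ∨ b j = 1) (hb' : ∀ j, b' j = 0 ∨ b' j = 1) (hSb : ∑ j, b j = 4 ∨ ∑ j, b j = 18)
    (hp : ∑ j, (b j + 7 * z j) * (b' j + 7 * z' j) = 4814) :
    ∑ j, b j = 18 ∧ 5 ≤ ∑ j, b j * b' j ∧ ∑ j, b j * b' j ≤ 12 := by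
  have e : ∑ j, (b j + 7 * z j) * (b' j + 7 * z' j)
      = ∑ j, b j * b' j + 7 * ∑ j, (b j * z' j + b' j * z j + 7 * (z j * z' j)) := by
    have : ∀ j ∈ (Finset.univ : Finset ι), (b j + 7 * z j) * (b' j + 7 * z' j)
        = b j * b' j + 7 * (b j * z' j + b' j * z j + 7 * (z j * z' j)) := by intro j _; ring
    rw [Finset.sum_congr rfl this, Finset.sum_add_distrib, Finset.mul_sum]
  have P0 : 0 ≤ ∑ j, b j * b' j :=
    Finset.sum_nonneg fun j _ => by rcases hb j with h | h <;> rcases hb' j with h' | h' <;> simp [h, h']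
  have P1 : ∑ j, b j * b' j ≤ ∑ j, b j :=
    Finset.sum_le_sum fun j _ => by rcases hb j with h | h <;> rcases hb' j with h' | h' <;> simp [h, h']
  rw [e] at hp
  generalize ∑ j, b j * b' j = P at *
  generalize ∑ j, (b j * z' j + b' j * z j + 7 * (z j * z' j)) = T at *
  generalize ∑ j, b j = Sb at *
  omega

/-! ## §C  The orbit matrix does not exist -/

/-- **Family F12, class `Z₂₉ ⋊ Z₇` — NONE (kernel theorem, orbit-matrix level).**  There are no `23 × 23` integer
matrices `b` (entries in {0,1}) and `z` (entries in {0,…,4}) such that `w = b + 7 z` has row sums 333, row second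
moments 4981 and row-pair products 4814.  Consequently no symmetric 2-(667,333,166) design, and no Hadamard matrix of
order 668, admits the Frobenius group `Z₂₉ ⋊ Z₇` (order 203) with all orbits of length 29 (FAMILY-F12 §2 for the
reduction; in print by Lander 1983 Thm 3.20 — this is the kernel-certified (−) control of the F12 calculus). -/
theorem no_frobenius29_index4 (b z : Fin 23 → Fin 23 → ℤ)
    (hb : ∀ i j, b i j = 0 ∨ b i j = 1) (hz : ∀ i j, 0 ≤ z i j ∧ z i j ≤ 4)
    (hR1 : ∀ i, ∑ j, (b i j + 7 * z i j) = 333)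
    (hR2 : ∀ i, ∑ j, (b i j + 7 * z i j) ^ 2 = 4981)
    (hP : ∀ i i', i ≠ i' → ∑ j, (b i j + 7 * z i j) * (b i' j + 7 * z i' j) = 4814) : False := by
  have h23 : Fintype.card (Fin 23) = 23 := Fintype.card_fin 23
  have rowA := fun i => orbitRow29_7 h23 (b i) (z i) (hb i) (hz i) (hR1 i) (hR2 i)
  have other : ∀ i : Fin 23, ∃ i' : Fin 23, i ≠ i' := by
    intro i
    by_cases h : i = 0
    · exact ⟨1, by rw [h]; decide⟩
    · exact ⟨0, h⟩
  have pairB := fun i i' (h : i ≠ i') =>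
    orbitPair29_7 (b i) (z i) (b i') (z i') (hb i) (hb i') (rowA i) (hP i i' h)
  -- every row has 18 base blocks
  have Sb18 : ∀ i, ∑ j, b i j = 18 := by
    intro i
    obtain ⟨i', hi'⟩ := other i
    exact (pairB i i' hi').1
  -- the base-block Gram matrix is bounded above …
  have diag : ∀ i, ∑ j, b i j * b i j = 18 := by
    intro i
    rw [← Sb18 i]
    exact Finset.sum_congr rfl fun j _ => by rcases hb i j with h | h <;> simp [h]
  have bound : ∀ i i', ∑ j, b i j * b i' j ≤ 12 + if i = i' then 6 else 0 := by
    intro i i'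
    split_ifs with h
    · rw [← h, diag i]; norm_num
    · rw [add_zero]; exact (pairB i i' h).2.2
  have T1 : ∑ i, ∑ i', ∑ j, b i j * b i' j ≤ 6486 :=
    calc ∑ i, ∑ i', ∑ j, b i j * b i' j ≤ ∑ i : Fin 23, ∑ i' : Fin 23, (12 + if i = i' then (6:ℤ) else 0) :=
          Finset.sum_le_sum fun i _ => Finset.sum_le_sum fun i' _ => bound i i'
      _ = 6486 := by simp [Finset.sum_add_distrib, Finset.sum_ite_eq]
  -- … and bounded below by Jensen on the column sums
  have colsum : ∑ j, ∑ i, b i j = 414 := by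
    rw [Finset.sum_comm]; simp [Sb18]
  have gram : ∑ i, ∑ i', ∑ j, b i j * b i' j = ∑ j, (∑ i, b i j) ^ 2 :=
    calc ∑ i, ∑ i', ∑ j, b i j * b i' j
        = ∑ i, ∑ j, ∑ i', b i j * b i' j := Finset.sum_congr rfl fun i _ => Finset.sum_comm
      _ = ∑ j, ∑ i, ∑ i', b i j * b i' j := Finset.sum_comm
      _ = ∑ j, (∑ i, b i j) * (∑ i', b i' j) := Finset.sum_congr rfl fun j _ => by rw [Finset.sum_mul_sum]
      _ = ∑ j, (∑ i, b i j) ^ 2 := Finset.sum_congr rfl fun j _ => by ring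
  have expand : ∑ j, (∑ i, b i j - 18) ^ 2 = ∑ j, (∑ i, b i j) ^ 2 - 36 * ∑ j, ∑ i, b i j + 7452 := by
    have : ∀ j ∈ (Finset.univ : Finset (Fin 23)), (∑ i, b i j - 18) ^ 2 = (∑ i, b i j) ^ 2 - 36 * ∑ i, b i j + 324 := by
      intro j _; ring
    rw [Finset.sum_congr rfl this, Finset.sum_add_distrib, Finset.sum_sub_distrib, Finset.mul_sum]
    simp
  have hsq : 0 ≤ ∑ j, (∑ i, b i j - 18) ^ 2 := Finset.sum_nonneg fun j _ => sq_nonneg _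
  rw [expand, colsum] at hsq
  rw [gram] at T1
  linarith

end Summit.Ventures.DiscreteObjects.Hadamard
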